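import Literature.IUT.LogVolume.Corollary22PartIILemmas
import Literature.IUT.LogVolume.Corollary22PartI
import Literature.NumberTheory.DiophantineGeometry.GenEllThm21
import Literature.NumberTheory.DiophantineGeometry.AbcWave0UniformABCProofs
import Mathlib.NumberTheory.Padics.HeightOneSpectrum
import HarnessLib

/-!
# [IUTchIV] Cor. 2.2 for the RATIONAL points of the `λ`-line: the Frey–Legendre dictionary of an abc triple

S. Mochizuki, *Inter-universal Teichmüller theory IV*, RIMS manuscript (Apr. 2020; = PRIMS **57** (2021)),
Cor. 2.2 (i)/(ii) pp. 41–48 (`log(q^∀)`, `log(q^{∤2})`, `ht_∞`, the Legendre curve of `λ`); S. Mochizuki,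
*Arithmetic elliptic curves in general position*, Math. J. Okayama Univ. **52** (2010), Thm. 2.1 p. 11 (the
point `λ = a/c` of an abc triple); J. H. Silverman, *The Arithmetic of Elliptic Curves*, III.1.7 (the Legendre
`j`-invariant `j(λ) = 2^8(λ²−λ+1)³/(λ²(λ−1)²)`).

Proof-only file (cell abc-iut, campaign S, seat abc-iut-S6; the `K_V`-FREE degree-one line). For an abc
triple `a + b = c` and the degree-one point `P = λ = a/c ∈ U_X(ℚ)` (the tree's `ratPoint`, abc-iut-S-d2's
dictionary `ht = log c`, `log-diff = 0`, `log-cond = log rad(abc)`), the curve `y² = x(x−1)(x−λ)` is a Frey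
curve: `j(a/c) = 2^8·(a²−ac+c²)³/(abc)²` with `gcd(a²−ac+c², abc) = 1`. Consequences recorded here, all
ELEMENTARY and unconditional:
* `Cor22.jInv_ratPoint_triple` — the displayed formula (`a² − ac + c² = cb + a²`) [cite: SilvermanAEC2009, §VIII.11];
* `Cor22.htInfty_ratPoint_triple_le` — `ht_∞(a/c) = h(j(a/c)) ≤ 6·log c + log 256` (numerator and
  denominator of the display are `≤ 256·c⁶`): the EXPLICIT archimedean input that replaces the compactly
  bounded `K_V` of Cor. 2.2 (ii) step (P4) at rational points;
* `Cor22.two_mul_log_oddPart_le_logQNotTwo` — `2·log (abc)_{odd} ≤ log(q^{∤2}(a/c))`: at an odd prime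
  `p ∣ abc` the local height is `−ord_p j(a/c) = 2·ord_p(abc)` (`(abc)_{odd} = ordCompl[2](abc)`, the odd
  part);
* `Cor22.natCast_le_two_mul_oddPart` — `c ≤ 2·(abc)_{odd}` (`(abc)_{odd} ≥ ab ≥ c − 1` if `c` is even, `≥ c`
  if `c` is odd).
These feed the `K_V`-free assembly `Corollary22DegreeOneSzpiro.lean`. Nothing here touches Theorem 1.10 or
[IUTchIII] Cor. 3.12; no side taken.
-/

noncomputable section

open scoped Classical

namespace Literature.IUT.LogVolume

namespace Cor22

open NumberField IsDedekindDomain Literature.NumberTheory.DiophantineGeometry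
open Literature.NumberTheory.DiophantineGeometry.GenEll Literature.NumberTheory.DiophantineGeometry.UniformABCConjecture

/-! ## Finite places of `ℚ` (the prime `p_v` under `v`) -/

/-- The prime under the place `primesEquiv⁻¹ p` over `p` is `p`. [folklore] -/
private theorem natGenerator_placeOf (p : ℕ) (hp : p.Prime) :
    Rat.HeightOneSpectrum.natGenerator ((Rat.HeightOneSpectrum.primesEquiv (R := 𝓞 ℚ)).symm ⟨p, hp⟩) = p :=
  congrArg Subtype.val ((Rat.HeightOneSpectrum.primesEquiv (R := 𝓞 ℚ)).apply_symm_apply ⟨p, hp⟩)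

/-- `p ↦ primesEquiv⁻¹ p` is injective on primes. [folklore] -/
private theorem placeOf_inj {p q : ℕ} (hp : p.Prime) (hq : q.Prime) (h : (Rat.HeightOneSpectrum.primesEquiv (R := 𝓞 ℚ)).symm ⟨p, hp⟩ = (Rat.HeightOneSpectrum.primesEquiv (R := 𝓞 ℚ)).symm ⟨q, hq⟩) : p = q := by
  have := congrArg Rat.HeightOneSpectrum.natGenerator h
  rwa [natGenerator_placeOf, natGenerator_placeOf] at this

/-- `log N(v) = log p_v` for a finite place `v` of `ℚ`. [folklore] -/
private theorem logNorm_rat (v : HeightOneSpectrum (𝓞 ℚ)) :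
    logNorm ℚ v = Real.log (Rat.HeightOneSpectrum.natGenerator v) := by
  rw [logNorm, absNorm_asIdeal_eq_natGenerator]

/-- A natural number prime to `p_v` has `ord_v = 0`. [folklore] -/
private theorem ord_rat_natCast_eq_zero_of_not_dvd (v : HeightOneSpectrum (𝓞 ℚ)) {n : ℕ}
    (h : ¬ Rat.HeightOneSpectrum.natGenerator v ∣ n) : ord ℚ v (n : ℚ) = 0 := by
  unfold ord
  rw [(valuation_natCast_eq_one_iff v n).2 h, WithZero.log_one, neg_zero]

/-- Natural numbers have `ord_v ≥ 0`. [folklore] -/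
private theorem ord_rat_natCast_nonneg (v : HeightOneSpectrum (𝓞 ℚ)) (n : ℕ) : 0 ≤ ord ℚ v (n : ℚ) := by
  simpa using ord_nonneg_of_isIntegral ℚ v (n : 𝓞 ℚ)

/-- The prime `p_v` under `v` has `ord_v(p_v) ≥ 1`. [folklore] -/
private theorem one_le_ord_rat_natGenerator (v : HeightOneSpectrum (𝓞 ℚ)) :
    1 ≤ ord ℚ v (Rat.HeightOneSpectrum.natGenerator v : ℚ) := by
  have hp : (Rat.HeightOneSpectrum.natGenerator v : 𝓞 ℚ) ≠ 0 := by
    exact_mod_cast (Rat.HeightOneSpectrum.prime_natGenerator v).ne_zero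
  have hmem : (Rat.HeightOneSpectrum.natGenerator v : 𝓞 ℚ) ∈ v.asIdeal :=
    (natCast_mem_asIdeal_iff v _).2 dvd_rfl
  have h : 0 < ord ℚ v (Rat.HeightOneSpectrum.natGenerator v : ℚ) := by
    simpa using (ord_pos_iff_mem ℚ v _ hp).2 hmem
  omega

/-- **`ord_v(n) ≥ v_{p_v}(n)`** for a natural number `n ≠ 0`: `n = p^k·m` with `k = v_p(n)` and `ord_v(p) ≥ 1`,
`ord_v(m) ≥ 0`. [folklore] -/
private theorem factorization_le_ord_rat_natCast (v : HeightOneSpectrum (𝓞 ℚ)) {n : ℕ} (hn : n ≠ 0) :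
    ((n.factorization (Rat.HeightOneSpectrum.natGenerator v) : ℕ) : ℤ) ≤ ord ℚ v (n : ℚ) := by
  set p := Rat.HeightOneSpectrum.natGenerator v with hp
  have hpp : p.Prime := Rat.HeightOneSpectrum.prime_natGenerator v
  set k := n.factorization p with hk
  set m := ordCompl[p] n with hm
  have hdec : (n : ℚ) = ((p : ℚ) ^ k) * (m : ℚ) := by
    have := Nat.ordProj_mul_ordCompl_eq_self n p
    rw [← hm] at this
    exact_mod_cast this.symm
  have hp0 : (p : ℚ) ≠ 0 := by exact_mod_cast hpp.ne_zero
  have hm0 : (m : ℚ) ≠ 0 := by exact_mod_cast (Nat.ordCompl_pos p hn).ne'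
  rw [hdec, ord_mul ℚ v (pow_ne_zero _ hp0) hm0, ord_pow]
  have h1 := one_le_ord_rat_natGenerator v
  have h2 := ord_rat_natCast_nonneg v m
  rw [← hp] at h1
  nlinarith

/-! ## The Frey–Legendre dictionary of an abc triple -/

section Triple

variable {a b c : ℕ}

/-- For an abc triple, `c > 0`, `a < c`, `gcd(a, c) = gcd(b, c) = 1`. [folklore] -/
private theorem basic (h : IsABCTriple a b c) :
    0 < c ∧ a < c ∧ Nat.Coprime a c ∧ Nat.Coprime b c ∧ a + b = c := by
  obtain ⟨ha, hb, habc, hcop⟩ := h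
  refine ⟨by omega, by omega, ?_, ?_, habc⟩
  · rw [← habc, Nat.coprime_self_add_right]; exact hcop
  · rw [← habc, add_comm, Nat.coprime_self_add_right]; exact hcop.symm

/-- **The Frey formula**: `j(a/c) = 2^8·(a² − ac + c²)³/(abc)²` with `a² − ac + c² = cb + a²`.
[cite: SilvermanAEC2009, Prop. III.1.7(b)] -/
theorem jInv_ratPoint_triple (h : IsABCTriple a b c) :
    jInv ((a : ℚ) / c) = ((256 * (c * b + a * a) ^ 3 : ℕ) : ℚ) / (((a * b * c) ^ 2 : ℕ) : ℚ) := by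
  obtain ⟨hc, hac, -, -, habc⟩ := basic h
  have ha : 0 < a := h.1
  have hb : 0 < b := h.2.1
  have hc0 : (c : ℚ) ≠ 0 := by exact_mod_cast hc.ne'
  have ha0 : (a : ℚ) ≠ 0 := by exact_mod_cast ha.ne'
  have hb0 : (b : ℚ) ≠ 0 := by exact_mod_cast hb.ne'
  have hbq : (b : ℚ) = c - a := by
    have : (a : ℚ) + b = c := by exact_mod_cast habc
    linarith
  have hK : (((c * b + a * a) : ℕ) : ℚ) = (a : ℚ) ^ 2 - a * c + (c : ℚ) ^ 2 := by
    push_cast; rw [hbq]; ring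
  have hsub : (a : ℚ) / c - 1 = -((b : ℚ) / c) := by rw [hbq]; field_simp; ring
  have hden : ((a : ℚ) / c) ^ 2 * ((a : ℚ) / c - 1) ^ 2 ≠ 0 := by
    rw [hsub]; exact mul_ne_zero (pow_ne_zero _ (div_ne_zero ha0 hc0))
      (pow_ne_zero _ (neg_ne_zero.mpr (div_ne_zero hb0 hc0)))
  unfold jInv
  rw [div_eq_div_iff hden (by positivity)]
  push_cast
  rw [hsub, hbq]
  field_simp
  ring

/-- An odd prime dividing `abc` does not divide `2^8·(a² − ac + c²)³` (`gcd(a² − ac + c², abc) = 1`: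
modulo a prime of `a` it is `≡ c²`, modulo a prime of `b` or `c` it is `≡ a²`). [folklore] -/
private theorem not_dvd_numerator (h : IsABCTriple a b c) {p : ℕ} (hp : p.Prime) (hp2 : p ≠ 2)
    (hpabc : p ∣ a * b * c) : ¬ p ∣ 256 * (c * b + a * a) ^ 3 := by
  obtain ⟨hc, hac, hcopac, hcopbc, habc⟩ := basic h
  have hcopab : Nat.Coprime a b := h.2.2.2
  intro hdvd
  have h256 : ¬ p ∣ 256 := by
    intro h'
    have : p ∣ 2 ^ 8 := by norm_num; exact h'
    exact hp2 ((Nat.prime_dvd_prime_iff_eq hp Nat.prime_two).mp (hp.dvd_of_dvd_pow this))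
  have hK : p ∣ (c * b + a * a) := by
    rcases (Nat.Prime.dvd_mul hp).mp hdvd with h' | h'
    · exact absurd h' h256
    · exact hp.dvd_of_dvd_pow h'
  -- `K = c·b + a·a`
  rcases (Nat.Prime.dvd_mul hp).mp hpabc with hab | hpc
  · rcases (Nat.Prime.dvd_mul hp).mp hab with hpa | hpb
    · -- `p ∣ a`: then `p ∣ c·b`, so `p ∣ c` or `p ∣ b`, contradicting coprimality
      have h1 : p ∣ c * b := by
        have : p ∣ a * a := dvd_mul_of_dvd_left hpa a
        exact (Nat.dvd_add_left this).mp hK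
      rcases (Nat.Prime.dvd_mul hp).mp h1 with hpc | hpb
      · exact hp.one_lt.ne' (Nat.eq_one_of_dvd_coprimes hcopac hpa hpc)
      · exact hp.one_lt.ne' (Nat.eq_one_of_dvd_coprimes hcopab hpa hpb)
    · -- `p ∣ b`: then `p ∣ a·a`
      have h1 : p ∣ a * a := by
        have : p ∣ c * b := dvd_mul_of_dvd_right hpb c
        exact (Nat.dvd_add_right this).mp hK
      have hpa := hp.dvd_of_dvd_pow (by simpa [sq] using h1 : p ∣ a ^ 2)
      exact hp.one_lt.ne' (Nat.eq_one_of_dvd_coprimes hcopab hpa hpb)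
  · -- `p ∣ c`: then `p ∣ a·a`
    have h1 : p ∣ a * a := by
      have : p ∣ c * b := dvd_mul_of_dvd_left hpc b
      exact (Nat.dvd_add_right this).mp hK
    have hpa := hp.dvd_of_dvd_pow (by simpa [sq] using h1 : p ∣ a ^ 2)
    exact hp.one_lt.ne' (Nat.eq_one_of_dvd_coprimes hcopac hpa hpc)

/-- **The local height at an odd prime of `abc`**: for the place `v` over an odd prime `p ∣ abc`,
`−ord_v j(a/c) = ord_v((abc)²) ≥ 2·v_p(abc)` (as an integer inequality on `ord`).
[cite: Mochizuki2012, IUTchIV Cor 2.2 proof p.44] -/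
theorem neg_ord_jInv_ratPoint_triple (h : IsABCTriple a b c) (v : HeightOneSpectrum (𝓞 ℚ))
    (hv2 : Rat.HeightOneSpectrum.natGenerator v ≠ 2) (hv : Rat.HeightOneSpectrum.natGenerator v ∣ a * b * c) :
    2 * (((a * b * c).factorization (Rat.HeightOneSpectrum.natGenerator v) : ℕ) : ℤ) ≤
      -ord ℚ v (jInv ((a : ℚ) / c)) := by
  obtain ⟨hc, -, -, -, -⟩ := basic h
  have habc0 : a * b * c ≠ 0 := Nat.mul_ne_zero (Nat.mul_ne_zero h.1.ne' h.2.1.ne') hc.ne'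
  have hp := Rat.HeightOneSpectrum.prime_natGenerator v
  have hN : ¬ Rat.HeightOneSpectrum.natGenerator v ∣ 256 * (c * b + a * a) ^ 3 := not_dvd_numerator h hp hv2 hv
  have hN0 : ((256 * (c * b + a * a) ^ 3 : ℕ) : ℚ) ≠ 0 := by
    have : 256 * (c * b + a * a) ^ 3 ≠ 0 := fun h0 => hN (h0 ▸ dvd_zero _)
    exact_mod_cast this
  have hD0 : (((a * b * c) ^ 2 : ℕ) : ℚ) ≠ 0 := by exact_mod_cast pow_ne_zero 2 habc0
  rw [jInv_ratPoint_triple h, div_eq_mul_inv, ord_mul ℚ v hN0 (inv_ne_zero hD0), ord_inv,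
    ord_rat_natCast_eq_zero_of_not_dvd v hN]
  have hsq : (((a * b * c) ^ 2 : ℕ) : ℚ) = ((a * b * c : ℕ) : ℚ) ^ 2 := by push_cast; ring
  rw [hsq, ord_pow]
  have := factorization_le_ord_rat_natCast v habc0
  simp only [Nat.cast_ofNat, zero_add, neg_neg]
  linarith

/-- **`2·log (abc)_{odd} ≤ log(q^{∤2}(a/c))`**, `(abc)_{odd} = ordCompl[2](abc)` the odd part: the places of `ℚ`
over the odd primes of `abc` are bad places not dividing `2`, each with local height `≥ 2·v_p(abc)` and
`log N(v) = log p`. [cite: Mochizuki2012, IUTchIV Cor 2.2 proof p.44] -/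
theorem two_mul_log_oddPart_le_logQNotTwo (h : IsABCTriple a b c) :
    2 * Real.log (ordCompl[2] (a * b * c) : ℕ) ≤ logQNotTwo (ratPoint ((a : ℚ) / c)) := by
  obtain ⟨hc, -, -, -, -⟩ := basic h
  set n := a * b * c with hn
  have hn0 : n ≠ 0 := Nat.mul_ne_zero (Nat.mul_ne_zero h.1.ne' h.2.1.ne') hc.ne'
  set m := ordCompl[2] n with hm
  have hm0 : m ≠ 0 := (Nat.ordCompl_pos 2 hn0).ne'
  set P := ratPoint ((a : ℚ) / c) with hP
  -- `log(q^{∤2}) = Σ_{v bad, v ∤ 2} h_v·log N(v)` (degree one)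
  have hdeg1 : (P.degree : ℝ) = 1 := by rw [hP, degree_ratPoint]; simp
  have hsum := degree_mul_logQAvoid P {2}
  rw [hdeg1, one_mul] at hsum
  obtain ⟨S, hsumS, hmemS, hnonneg⟩ : ∃ S : Finset (HeightOneSpectrum (𝓞 P.F)),
      logQNotTwo P = ∑ v ∈ S, localHeight P v * logNorm P.F v ∧
      (∀ v, v ∈ badPlaces P → ((2 : ℕ) : 𝓞 P.F) ∉ v.asIdeal → v ∈ S) ∧
      (∀ v ∈ S, 0 ≤ localHeight P v * logNorm P.F v) :=
    ⟨_, hsum, fun v h1 h2 => Finset.mem_filter.mpr ⟨h1, fun p hp => by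
        rw [Finset.mem_singleton] at hp; subst hp; exact h2⟩,
      fun v _ => mul_nonneg (localHeight_nonneg P v) (logNorm_pos P.F v).le⟩
  -- facts about the odd prime factors of `abc`
  have hfac : ∀ q ∈ m.primeFactors, q ≠ 2 ∧ q ∣ n ∧ m.factorization q = n.factorization q := by
    intro q hq
    have hqm : q ∣ m := Nat.dvd_of_mem_primeFactors hq
    have hq2 : q ≠ 2 := by
      rintro rfl
      have hcop := Nat.coprime_ordCompl Nat.prime_two hn0
      rw [← hm] at hcop
      exact (Nat.Prime.coprime_iff_not_dvd Nat.prime_two).mp hcop hqm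
    refine ⟨hq2, hqm.trans (Nat.ordCompl_dvd n 2), ?_⟩
    rw [hm, Nat.factorization_ordCompl, Finsupp.erase_ne hq2]
  -- the places over the odd prime factors, as places of the presenting field `P.F = ℚ`
  set f : {x // x ∈ m.primeFactors} → HeightOneSpectrum (𝓞 P.F) :=
    fun q => (Rat.HeightOneSpectrum.primesEquiv (R := 𝓞 ℚ)).symm ⟨q.1, Nat.prime_of_mem_primeFactors q.2⟩ with hf
  -- the place over an odd prime factor `q`: bad, prime to `2`, local height `≥ 2·v_q(n)`
  have hplace : ∀ q : {x // x ∈ m.primeFactors},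
      f q ∈ S ∧ ((2 * n.factorization q.1 : ℕ) : ℝ) * Real.log q.1 ≤ localHeight P (f q) * logNorm P.F (f q) := by
    rintro ⟨q, hq⟩
    obtain ⟨hq2, hqn, -⟩ := hfac q hq
    have hqp := Nat.prime_of_mem_primeFactors hq
    have hgen := natGenerator_placeOf q hqp
    have hle := neg_ord_jInv_ratPoint_triple h ((Rat.HeightOneSpectrum.primesEquiv (R := 𝓞 ℚ)).symm ⟨q, hqp⟩) (by rw [hgen]; exact hq2)
      (by rw [hgen]; exact hqn)
    rw [hgen] at hle
    have hk : 1 ≤ n.factorization q := (hqp.dvd_iff_one_le_factorization hn0).mp hqn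
    have hkz : (1 : ℤ) ≤ n.factorization q := by exact_mod_cast hk
    have hfq : f ⟨q, hq⟩ = (Rat.HeightOneSpectrum.primesEquiv (R := 𝓞 ℚ)).symm ⟨q, hqp⟩ := rfl
    refine ⟨hmemS _ ?_ ?_, ?_⟩
    · rw [mem_badPlaces_iff_ord_neg, hfq]
      change ord ℚ ((Rat.HeightOneSpectrum.primesEquiv (R := 𝓞 ℚ)).symm ⟨q, hqp⟩) (jInv ((a : ℚ) / c)) < 0
      linarith
    · rw [hfq]
      change ((2 : ℕ) : 𝓞 ℚ) ∉ ((Rat.HeightOneSpectrum.primesEquiv (R := 𝓞 ℚ)).symm ⟨q, hqp⟩).asIdeal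
      rw [natCast_mem_asIdeal_iff, hgen]
      intro h2
      exact hq2 ((Nat.prime_dvd_prime_iff_eq hqp Nat.prime_two).mp h2)
    · have hlog : logNorm P.F (f ⟨q, hq⟩) = Real.log q := by
        rw [hfq]
        change logNorm ℚ ((Rat.HeightOneSpectrum.primesEquiv (R := 𝓞 ℚ)).symm ⟨q, hqp⟩) = _
        rw [logNorm_rat, hgen]
      have hloc : ((2 * n.factorization q : ℕ) : ℝ) ≤ localHeight P (f ⟨q, hq⟩) := by
        rw [hfq]
        change _ ≤ (((-(ord ℚ ((Rat.HeightOneSpectrum.primesEquiv (R := 𝓞 ℚ)).symm ⟨q, hqp⟩) (jInv ((a : ℚ) / c)))).toNat : ℕ) : ℝ)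
        have h0 : 0 ≤ -(ord ℚ ((Rat.HeightOneSpectrum.primesEquiv (R := 𝓞 ℚ)).symm ⟨q, hqp⟩) (jInv ((a : ℚ) / c))) := by linarith
        have hz : ((2 * n.factorization q : ℕ) : ℤ) ≤
            ((-(ord ℚ ((Rat.HeightOneSpectrum.primesEquiv (R := 𝓞 ℚ)).symm ⟨q, hqp⟩) (jInv ((a : ℚ) / c)))).toNat : ℤ) := by
          rw [Int.toNat_of_nonneg h0]; push_cast; linarith
        exact_mod_cast hz
      rw [hlog]
      exact mul_le_mul_of_nonneg_right hloc (Real.log_nonneg (by exact_mod_cast hqp.one_lt.le))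
  -- the sub-sum over the places of the odd prime factors
  have hinj : Set.InjOn f ↑(m.primeFactors.attach) := by
    rintro ⟨q, hq⟩ _ ⟨q', hq'⟩ _ hqq
    exact Subtype.ext (placeOf_inj _ _ hqq)
  set T : Finset (HeightOneSpectrum (𝓞 P.F)) := m.primeFactors.attach.image f with hT
  have hTsub : T ⊆ S := by
    intro v hv
    rw [hT, Finset.mem_image] at hv
    obtain ⟨q, -, rfl⟩ := hv
    exact (hplace q).1
  have hge : ∑ v ∈ T, localHeight P v * logNorm P.F v ≤ logQNotTwo P := by
    rw [hsumS]; exact Finset.sum_le_sum_of_subset_of_nonneg hTsub fun v hv _ => hnonneg v hv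
  have hTsum : ∑ v ∈ T, localHeight P v * logNorm P.F v =
      ∑ q ∈ m.primeFactors.attach, localHeight P (f q) * logNorm P.F (f q) := by
    rw [hT, Finset.sum_image hinj]
  -- `log m = Σ_{q ∣ m} v_q(m)·log q = Σ v_q(n)·log q`
  have hlogm : Real.log (m : ℝ) =
      ∑ q ∈ m.primeFactors.attach, ((n.factorization q.1 : ℕ) : ℝ) * Real.log q.1 := by
    rw [Finset.sum_attach m.primeFactors (fun q => ((n.factorization q : ℕ) : ℝ) * Real.log q)]
    conv_lhs => rw [← Nat.prod_factorization_pow_eq_self hm0]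
    rw [Finsupp.prod, Nat.support_factorization, Nat.cast_prod, Real.log_prod]
    · refine Finset.sum_congr rfl fun q hq => ?_
      rw [Nat.cast_pow, Real.log_pow, (hfac q hq).2.2]
    · intro q hq
      have := (Nat.prime_of_mem_primeFactors hq).pos
      positivity
  calc 2 * Real.log (m : ℝ)
      = ∑ q ∈ m.primeFactors.attach, ((2 * n.factorization q.1 : ℕ) : ℝ) * Real.log q.1 := by
        rw [hlogm, Finset.mul_sum]
        exact Finset.sum_congr rfl fun q _ => by push_cast; ring
    _ ≤ ∑ q ∈ m.primeFactors.attach, localHeight P (f q) * logNorm P.F (f q) :=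
        Finset.sum_le_sum fun q _ => (hplace q).2
    _ = ∑ v ∈ T, localHeight P v * logNorm P.F v := hTsum.symm
    _ ≤ logQNotTwo P := hge

/-- **`c ≤ 2·(abc)_{odd}`**: if `c` is odd then `(abc)_{odd} = a_{odd}·b_{odd}·c ≥ c`; if `c` is even then `a, b`
are odd and `(abc)_{odd} ≥ ab ≥ a + b − 1 = c − 1 ≥ c/2` — the elementary comparison of `c` with the
odd part of `16(abc)² = Δ` of the Frey curve. [cite: SilvermanAEC2009, §VIII.11] -/
theorem natCast_le_two_mul_oddPart (h : IsABCTriple a b c) :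
    (c : ℝ) ≤ 2 * (ordCompl[2] (a * b * c) : ℕ) := by
  obtain ⟨hc, -, -, -, habc⟩ := basic h
  have ha : 0 < a := h.1
  have hb : 0 < b := h.2.1
  have hcop : Nat.Coprime a b := h.2.2.2
  have key : c ≤ 2 * ordCompl[2] (a * b * c) := by
    rw [Nat.ordCompl_mul, Nat.ordCompl_mul]
    by_cases h2c : 2 ∣ c
    · -- `c` even: `a`, `b` odd
      have h2a : ¬ 2 ∣ a := by
        intro h2a
        have h2b : 2 ∣ b := by
          have : 2 ∣ a + b := habc ▸ h2c
          exact (Nat.dvd_add_right h2a).mp this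
        have := Nat.eq_one_of_dvd_coprimes hcop h2a h2b
        omega
      have h2b : ¬ 2 ∣ b := by
        intro h2b
        have : 2 ∣ a + b := habc ▸ h2c
        exact h2a ((Nat.dvd_add_left h2b).mp this)
      have hA : ordCompl[2] a = a := (Nat.ordCompl_eq_self_iff_zero_or_not_dvd a Nat.prime_two).mpr (Or.inr h2a)
      have hB : ordCompl[2] b = b := (Nat.ordCompl_eq_self_iff_zero_or_not_dvd b Nat.prime_two).mpr (Or.inr h2b)
      have hC : 1 ≤ ordCompl[2] c := Nat.ordCompl_pos 2 hc.ne'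
      rw [hA, hB]
      have hab : a + b ≤ a * b + 1 := by
        have hz : 0 ≤ ((a : ℤ) - 1) * ((b : ℤ) - 1) := mul_nonneg (by omega) (by omega)
        have : (a : ℤ) + b ≤ a * b + 1 := by nlinarith
        exact_mod_cast this
      have hab1 : 1 ≤ a * b := Nat.one_le_iff_ne_zero.mpr (Nat.mul_ne_zero ha.ne' hb.ne')
      calc c = a + b := habc.symm
        _ ≤ 2 * (a * b) := by omega
        _ ≤ 2 * (a * b * ordCompl[2] c) := by nlinarith
    · -- `c` odd
      have hC : ordCompl[2] c = c := (Nat.ordCompl_eq_self_iff_zero_or_not_dvd c Nat.prime_two).mpr (Or.inr h2c)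
      have hA : 1 ≤ ordCompl[2] a := Nat.ordCompl_pos 2 ha.ne'
      have hB : 1 ≤ ordCompl[2] b := Nat.ordCompl_pos 2 hb.ne'
      rw [hC]
      calc c = 1 * 1 * c := by ring
        _ ≤ ordCompl[2] a * ordCompl[2] b * c := by gcongr
        _ ≤ 2 * (ordCompl[2] a * ordCompl[2] b * c) := by omega
  exact_mod_cast key

/-- **`ht_∞(a/c) ≤ 6·log c + log 256`**: `ht_∞ = h(j(a/c))` (degree one, Mathlib `Rat.logHeight₁_eq_log_max`) and
both `2^8·(a²−ac+c²)³ ≤ 256·c⁶` and `(abc)² ≤ c⁶` (`a² − ac + c² = cb + a² ≤ c²` as `a, b ≤ c`). The explicit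
archimedean input of the `K_V`-free degree-one line. [cite: Mochizuki2012, IUTchIV Cor 2.2 (i) p.41] -/
theorem htInfty_ratPoint_triple_le (h : IsABCTriple a b c) :
    htInfty (ratPoint ((a : ℚ) / c)) ≤ 6 * Real.log c + Real.log 256 := by
  obtain ⟨hc, hac, -, -, habc⟩ := basic h
  have ha : 0 < a := h.1
  have hb : 0 < b := h.2.1
  have hbc : b ≤ c := by omega
  set N₀ : ℕ := 256 * (c * b + a * a) ^ 3 with hN₀
  set D₀ : ℕ := (a * b * c) ^ 2 with hD₀
  have habc0 : a * b * c ≠ 0 := Nat.mul_ne_zero (Nat.mul_ne_zero ha.ne' hb.ne') hc.ne'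
  have hD₀0 : D₀ ≠ 0 := pow_ne_zero 2 habc0
  -- sizes
  have hKle : (c * b + a * a) ≤ c ^ 2 := by
    calc c * b + a * a ≤ c * b + a * c := by nlinarith
      _ = c * (a + b) := by ring
      _ = c ^ 2 := by rw [habc]; ring
  have hN₀le : N₀ ≤ 256 * c ^ 6 := by
    calc N₀ = 256 * (c * b + a * a) ^ 3 := rfl
      _ ≤ 256 * (c ^ 2) ^ 3 := by gcongr
      _ = 256 * c ^ 6 := by ring
  have hD₀le : D₀ ≤ 256 * c ^ 6 := by
    calc D₀ = (a * b * c) ^ 2 := rfl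
      _ ≤ (c * c * c) ^ 2 := by gcongr
      _ = c ^ 6 := by ring
      _ ≤ 256 * c ^ 6 := by omega
  -- the `j`-invariant as a fraction of naturals
  set q : ℚ := jInv ((a : ℚ) / c) with hq
  have hqeq : q = ((N₀ : ℤ) : ℚ) / ((D₀ : ℤ) : ℚ) := by
    rw [hq, jInv_ratPoint_triple h, Int.cast_natCast, Int.cast_natCast]
  have hqdiv : q = Rat.divInt (N₀ : ℤ) (D₀ : ℤ) := by rw [hqeq, Rat.divInt_eq_div]
  have hN₀pos : 0 < N₀ := by
    have hK1 : 1 ≤ (c * b + a * a) := by nlinarith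
    rw [hN₀]; positivity
  have hnum : q.num.natAbs ≤ N₀ := by
    have h1 : q.num ∣ (N₀ : ℤ) := by rw [hqdiv]; exact Rat.num_dvd _ (by exact_mod_cast hD₀0)
    have h2 : q.num.natAbs ∣ N₀ := by
      have := Int.natAbs_dvd_natAbs.mpr h1
      simpa using this
    exact Nat.le_of_dvd hN₀pos h2
  have hden : q.den ≤ D₀ := by
    have h1 : (q.den : ℤ) ∣ (D₀ : ℤ) := by rw [hqdiv]; exact Rat.den_dvd _ _
    have h2 : q.den ∣ D₀ := by exact_mod_cast h1
    exact Nat.le_of_dvd (Nat.pos_of_ne_zero hD₀0) h2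
  have hmax : (max q.num.natAbs q.den : ℕ) ≤ 256 * c ^ 6 :=
    max_le (hnum.trans hN₀le) (hden.trans hD₀le)
  -- `ht_∞ = log max(|num|, den)` at a degree-one point
  have hht : htInfty (ratPoint ((a : ℚ) / c)) = Real.log (max q.num.natAbs q.den : ℕ) := by
    unfold htInfty
    rw [degree_ratPoint]
    change ((1 : ℕ) : ℝ)⁻¹ * Height.logHeight₁ (jInv ((a : ℚ) / c)) = _
    rw [Nat.cast_one, inv_one, one_mul, ← hq, Rat.logHeight₁_eq_log_max]
  rw [hht]
  have hpos : (0 : ℝ) < (max q.num.natAbs q.den : ℕ) := by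
    have : 0 < q.den := q.den_pos
    exact_mod_cast lt_of_lt_of_le this (le_max_right _ _)
  have hc0 : (0 : ℝ) < c := by exact_mod_cast hc
  calc Real.log (max q.num.natAbs q.den : ℕ) ≤ Real.log ((256 * c ^ 6 : ℕ) : ℝ) :=
        Real.log_le_log hpos (by exact_mod_cast hmax)
    _ = 6 * Real.log c + Real.log 256 := by
        push_cast
        rw [Real.log_mul (by norm_num) (by positivity), Real.log_pow]; push_cast; ring

end Triple

end Cor22

end Literature.IUT.LogVolume

end
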